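import Literature.NumberTheory.LFunctions.LogZetaClassicalRegion
import Literature.NumberTheory.LFunctions.MontgomeryVaughan2001PrimeSums
import Literature.NumberTheory.LFunctions.ZetaLogDerivDisc
import Mathlib.Analysis.Calculus.MeanValue
import HarnessLib

/-!
# `|log ζ(s)| ≤ log log τ + O(1)` in the classical zero-free region (Montgomery–Vaughan Thm. 6.7)

Topic `Literature/NumberTheory/LFunctions`. Everything here is PROVED (theorems only). Support
file for the Sathe–Selberg formula (`SatheSelberg.lean`,
`Literature.NumberTheory.LFunctions.MontgomeryVaughan2007_exercise_7_4_3c`): the bounds on the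
tree's holomorphic logarithm `logZeta₁` of `ζ₁(s) = (s − 1)ζ(s)` (`LogZetaClassicalRegion.lean`)
that control the complex powers `ζ(s)^z = exp(z (logZeta₁ s − Log(s − 1)))` on the contour of the
Selberg–Delange method:

* `norm_eulerLogZeta_le` — on `σ > 1`: `‖∑_p −Log(1 − p^{−s})‖ ≤ log(σ/(σ − 1))` (termwise
  `‖Log(1 − q)‖ ≤ −log(1 − ‖q‖)` and `ζ(σ) ≤ σ/(σ − 1)`);
* `exists_norm_logZeta_sub_log_le` — **MV Theorem 6.7, third estimate of (6.6)**:
  `‖logZeta₁ s − Log(s − 1)‖ ≤ log log(|t| + 3) + C₀` for `s` in the region with `|t| ≥ 1`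
  (integrate `ζ'/ζ ≪ log τ` from `σ₁ = 1 + 1/log τ`, where the Euler product gives `log(log τ + 1)`);
* `exists_norm_logZeta₁_le_near_one` — `logZeta₁` is bounded on a fixed compact box around `s = 1`.

## References

* [MontgomeryVaughan2007] H. L. Montgomery, R. C. Vaughan, *Multiplicative Number Theory I*,
  CUP 2007, Theorem 6.7 (6.6) and its proof, p. 174.
-/

noncomputable section

open Complex Set Filter Topology Metric

namespace Literature.NumberTheory.LFunctions

namespace SatheSelberg

open Nicolas

/-! ### The Euler logarithm on `σ > 1` -/

/-- The two names of the Euler logarithm in the tree agree: `eulerLogZeta = primeZetaLog`. [folklore] -/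
theorem eulerLogZeta_eq_primeZetaLog : eulerLogZeta = primeZetaLog := rfl

/-- `‖Log(1 − q)‖ ≤ −log(1 − ‖q‖)` for `‖q‖ < 1` (Mercator series). [folklore] -/
theorem norm_log_one_sub_le {q : ℂ} (hq : ‖q‖ < 1) :
    ‖Complex.log (1 - q)‖ ≤ -Real.log (1 - ‖q‖) := by
  have h := MontgomeryVaughan2001.norm_neg_log_sub_le_of_real_mul hq le_rfl zero_le_one
  simpa using h

/-- The terms of the Euler logarithm at a real point are real:
`−Log(1 − p^{−σ}) = −log(1 − p^{−σ})`. [folklore] -/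
theorem neg_log_one_sub_primes_cpow_ofReal (p : Nat.Primes) {σ : ℝ} (hσ : 0 < σ) :
    -Complex.log (1 - ((p : ℕ) : ℂ) ^ (-(σ : ℂ))) =
      ((-Real.log (1 - ((p : ℕ) : ℝ) ^ (-σ)) : ℝ) : ℂ) := by
  have hp : (0 : ℝ) < 1 - ((p : ℕ) : ℝ) ^ (-σ) := by
    have h1 : ((p : ℕ) : ℝ) ^ (-σ) < 1 :=
      Real.rpow_lt_one_of_one_lt_of_neg (by exact_mod_cast p.2.one_lt) (by linarith)
    linarith
  rw [primes_cpow_neg_ofReal, ofReal_neg, ofReal_log hp.le]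
  simp

/-- **`‖∑_p −Log(1 − p^{−s})‖ ≤ log(σ/(σ − 1))`** for `σ = Re s > 1`: termwise
`‖Log(1 − p^{−s})‖ ≤ −log(1 − p^{−σ})`, and `∑_p −log(1 − p^{−σ}) = log ζ(σ) ≤ log(σ/(σ−1))`.
[cite: MontgomeryVaughan2007, proof of Theorem 6.7] -/
theorem norm_eulerLogZeta_le {s : ℂ} (hs : 1 < s.re) :
    ‖eulerLogZeta s‖ ≤ Real.log (s.re / (s.re - 1)) := by
  set σ : ℝ := s.re with hσdef
  have hσ : 1 < σ := hs
  have hσ' : 1 < (σ : ℂ).re := by simpa using hσ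
  have hsumC := summable_primeZetaLog (w := s) hs
  have hsumσ := summable_primeZetaLog (w := (σ : ℂ)) hσ'
  have e : (fun p : Nat.Primes ↦ -Complex.log (1 - ((p : ℕ) : ℂ) ^ (-(σ : ℂ)))) =
      fun p : Nat.Primes ↦ ((-Real.log (1 - ((p : ℕ) : ℝ) ^ (-σ)) : ℝ) : ℂ) := by
    funext p; exact neg_log_one_sub_primes_cpow_ofReal p (by linarith)
  have hsumR : Summable fun p : Nat.Primes ↦ -Real.log (1 - ((p : ℕ) : ℝ) ^ (-σ)) := by
    rw [e, Complex.summable_ofReal] at hsumσ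
    exact hsumσ
  -- the real series is `log ζ(σ)`
  have hnorm := MontgomeryVaughan2001.norm_riemannZeta_eq_exp_re hσ'
  rw [primeZetaLog_ofReal hσ, ofReal_re] at hnorm
  have hζpos : 0 < ‖riemannZeta (σ : ℂ)‖ := by rw [hnorm]; exact Real.exp_pos _
  have hS : ∑' p : Nat.Primes, -Real.log (1 - ((p : ℕ) : ℝ) ^ (-σ)) =
      Real.log ‖riemannZeta (σ : ℂ)‖ := by rw [hnorm, Real.log_exp]
  have hζ : Real.log ‖riemannZeta (σ : ℂ)‖ ≤ Real.log (σ / (σ - 1)) :=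
    Real.log_le_log hζpos (MontgomeryVaughan2001.norm_zeta_real_le hσ)
  -- termwise comparison
  have hterm : ∀ p : Nat.Primes, ‖-Complex.log (1 - ((p : ℕ) : ℂ) ^ (-s))‖ ≤
      -Real.log (1 - ((p : ℕ) : ℝ) ^ (-σ)) := by
    intro p
    rw [norm_neg, ← norm_primes_cpow_neg p s]
    exact norm_log_one_sub_le (norm_primes_cpow_neg_lt_one p (by linarith))
  calc ‖eulerLogZeta s‖ ≤ ∑' p : Nat.Primes, ‖-Complex.log (1 - ((p : ℕ) : ℂ) ^ (-s))‖ :=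
        norm_tsum_le_tsum_norm hsumC.norm
    _ ≤ ∑' p : Nat.Primes, -Real.log (1 - ((p : ℕ) : ℝ) ^ (-σ)) :=
        hsumC.norm.tsum_le_tsum hterm hsumR
    _ = Real.log ‖riemannZeta (σ : ℂ)‖ := hS
    _ ≤ Real.log (σ / (σ - 1)) := hζ

/-- At `σ₁ = 1 + 1/ℓ` (`ℓ > 0`): `log(σ₁/(σ₁ − 1)) = log(ℓ + 1)`. [folklore] -/
theorem log_div_sub_one_eq {ℓ : ℝ} (hℓ : 0 < ℓ) :
    Real.log ((1 + 1 / ℓ) / (1 + 1 / ℓ - 1)) = Real.log (ℓ + 1) := by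
  congr 1
  field_simp
  ring

/-- For `σ ≥ σ₁ > 1`: `log(σ/(σ−1)) ≤ log(σ₁/(σ₁−1))` (the map `σ ↦ σ/(σ−1)` decreases). [folklore] -/
theorem log_div_sub_one_anti {σ σ₁ : ℝ} (hσ₁ : 1 < σ₁) (h : σ₁ ≤ σ) :
    Real.log (σ / (σ - 1)) ≤ Real.log (σ₁ / (σ₁ - 1)) := by
  have h1 : 0 < σ - 1 := by linarith
  have h2 : 0 < σ₁ - 1 := by linarith
  refine Real.log_le_log (div_pos (by linarith) h1) ?_
  rw [div_le_div_iff₀ h1 h2]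
  nlinarith

/-! ### `log ζ(s) ≪ log log τ` in the region (MV Theorem 6.7) -/

/-- On `σ > 1` the Euler logarithm bound in the `τ`-scale: for `σ ≥ 1 + 1/log(|t| + 3)`,
`‖logZeta₁ s − Log(s − 1)‖ ≤ log log(|t| + 3) + log 2`. [cite: MontgomeryVaughan2007, Theorem 6.7] -/
theorem norm_logZeta_sub_log_le_of_le_re {s : ℂ}
    (hs : 1 + 1 / Real.log (|s.im| + 3) ≤ s.re) :
    ‖logZeta₁ s - Complex.log (s - 1)‖ ≤
      Real.log (Real.log (|s.im| + 3)) + Real.log 2 := by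
  set ℓ : ℝ := Real.log (|s.im| + 3) with hℓ
  have hℓ1 : 1 < ℓ := ZetaClassicalRegion.one_lt_log_abs_add_three s.im
  have hℓ0 : 0 < ℓ := by linarith
  have hσ₁ : 1 < 1 + 1 / ℓ := by
    have : 0 < 1 / ℓ := by positivity
    linarith
  have hs1 : 1 < s.re := lt_of_lt_of_le hσ₁ hs
  rw [logZeta₁_eq_eulerLogZeta_add_log hs1, add_sub_cancel_right]
  calc ‖eulerLogZeta s‖ ≤ Real.log (s.re / (s.re - 1)) := norm_eulerLogZeta_le hs1
    _ ≤ Real.log ((1 + 1 / ℓ) / (1 + 1 / ℓ - 1)) := log_div_sub_one_anti hσ₁ hs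
    _ = Real.log (ℓ + 1) := log_div_sub_one_eq hℓ0
    _ ≤ Real.log (2 * ℓ) := Real.log_le_log (by linarith) (by linarith)
    _ = Real.log ℓ + Real.log 2 := by
        rw [Real.log_mul (by norm_num) hℓ0.ne', add_comm]

/-- The derivative of `logZeta₁ s − Log(s − 1)` off the real axis is `ζ'/ζ(s)`. [folklore] -/
theorem hasDerivAt_logZeta₁_sub_log {s : ℂ} (hs : s ∈ zfrRegion) (him : s.im ≠ 0) :
    HasDerivAt (fun w ↦ logZeta₁ w - Complex.log (w - 1))
      (deriv riemannZeta s / riemannZeta s) s := by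
  have hs1 : s ≠ 1 := fun h ↦ him (by rw [h]; simp)
  have hζ : riemannZeta s ≠ 0 := riemannZeta_ne_zero_of_mem_zfrRegion hs hs1
  have hslit : s - 1 ∈ slitPlane := mem_slitPlane_iff.2 (Or.inr (by simpa using him))
  have h1 := hasDerivAt_logZeta₁ hs
  have h2 : HasDerivAt (fun w : ℂ ↦ Complex.log (w - 1)) (1 / (s - 1)) s := by
    simpa using ((hasDerivAt_id s).sub_const 1).clog hslit
  have h := h1.sub h2
  have key : deriv riemannZeta₁ s / riemannZeta₁ s - 1 / (s - 1) =
      deriv riemannZeta s / riemannZeta s := by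
    have := logDeriv_riemannZeta_eq hs1 hζ
    rw [logDeriv_apply, logDeriv_apply] at this
    rw [this, one_div]
  rwa [key] at h

/-- **Montgomery–Vaughan Theorem 6.7 (third estimate of (6.6)): `|log ζ(s)| ≤ log log τ + O(1)`
in the classical region**, here for the tree's branch `logZeta₁ s − Log(s − 1)` of `log ζ(s)` on
`Ω = zfrRegion`: there is an absolute `C₀ ≥ 0` with
`‖logZeta₁ s − Log(s − 1)‖ ≤ log log(|t| + 3) + C₀` for all `s ∈ Ω` with `|t| ≥ 1`.
Proof as printed: trivial for `σ ≥ σ₁ = 1 + 1/log τ` by the Euler product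
(`norm_logZeta_sub_log_le_of_le_re`); for smaller `σ` integrate `ζ'/ζ ≪ log τ` along `[σ, σ₁]`.
[cite: MontgomeryVaughan2007, Theorem 6.7 (6.6)] -/
theorem exists_norm_logZeta_sub_log_le :
    ∃ C₀ : ℝ, 0 ≤ C₀ ∧ ∀ s : ℂ, s ∈ zfrRegion → 1 ≤ |s.im| →
      ‖logZeta₁ s - Complex.log (s - 1)‖ ≤ Real.log (Real.log (|s.im| + 3)) + C₀ := by
  set C : ℝ := zfrBoundConst with hC
  have hCpos : 0 < C := zfrBoundConst_pos
  have hc := zfrConst_pos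
  refine ⟨Real.log 2 + (C + 1) * (1 + 4 * zfrConst), by positivity, fun s hs ht ↦ ?_⟩
  set t : ℝ := s.im with htdef
  set ℓ : ℝ := Real.log (|t| + 3) with hℓ
  have hℓ1 : 1 < ℓ := ZetaClassicalRegion.one_lt_log_abs_add_three t
  have hℓ0 : 0 < ℓ := by linarith
  set σ₁ : ℝ := 1 + 1 / ℓ with hσ₁def
  have hσ₁ : 1 < σ₁ := by
    have : 0 < 1 / ℓ := by positivity
    simp only [hσ₁def]; linarith
  have hlog2 : 0 < Real.log 2 := Real.log_pos one_lt_two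
  by_cases hcase : σ₁ ≤ s.re
  · calc ‖logZeta₁ s - Complex.log (s - 1)‖ ≤ Real.log ℓ + Real.log 2 :=
          norm_logZeta_sub_log_le_of_le_re hcase
      _ ≤ Real.log ℓ + (Real.log 2 + (C + 1) * (1 + 4 * zfrConst)) := by
          have : 0 ≤ (C + 1) * (1 + 4 * zfrConst) := by positivity
          linarith
  push Not at hcase
  -- the horizontal segment `u + it`, `u ∈ [σ, σ₁]`, inside the region and off the real axis
  set σ : ℝ := s.re with hσdef
  have hσΩ : 1 - zfrWidth t < σ := hs
  have him : t ≠ 0 := fun h ↦ by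
    rw [h, abs_zero] at ht; exact absurd ht (by norm_num)
  set g : ℝ → ℂ := fun u ↦ logZeta₁ ((u : ℂ) + t * I) - Complex.log ((u : ℂ) + t * I - 1)
    with hgdef
  have hmem : ∀ u : ℝ, σ ≤ u → ((u : ℂ) + t * I) ∈ zfrRegion := by
    intro u hu
    show 1 - zfrWidth ((u : ℂ) + t * I).im < ((u : ℂ) + t * I).re
    simpa using lt_of_lt_of_le hσΩ hu
  have him' : ∀ u : ℝ, ((u : ℂ) + t * I).im ≠ 0 := fun u ↦ by simpa using him
  -- derivative of `g`
  have hderiv : ∀ u : ℝ, σ ≤ u → HasDerivAt g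
      (deriv riemannZeta ((u : ℂ) + t * I) / riemannZeta ((u : ℂ) + t * I)) u := by
    intro u hu
    have h1 := hasDerivAt_logZeta₁_sub_log (hmem u hu) (him' u)
    have h2 : HasDerivAt (fun w : ℂ ↦ w + t * I) 1 (u : ℂ) := (hasDerivAt_id _).add_const _
    have h3 := h1.comp (u : ℂ) h2
    rw [mul_one] at h3
    exact h3.comp_ofReal
  -- bound for the derivative on the segment
  have hbound : ∀ u : ℝ, σ ≤ u →
      ‖deriv riemannZeta ((u : ℂ) + t * I) / riemannZeta ((u : ℂ) + t * I)‖ ≤ C * ℓ + 1 := by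
    intro u hu
    set w : ℂ := (u : ℂ) + t * I with hw
    have hw1 : w ≠ 1 := fun h ↦ him' u (by rw [← hw, h]; simp)
    have hwim : w.im = t := by simp [hw]
    have hwre : w.re = u := by simp [hw]
    have hreg : 1 - 4 * zfrConst / Real.log (|w.im| + 3) ≤ w.re := by
      rw [hwim, hwre]
      have : zfrWidth t = 4 * zfrConst / Real.log (|t| + 3) := rfl
      linarith
    obtain ⟨-, -, -, h4⟩ := zfr_bounds hw1 hreg
    rw [hwim] at h4
    have hinv : ‖1 / (w - 1)‖ ≤ 1 := by
      rw [norm_div, norm_one]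
      have : |t| ≤ ‖w - 1‖ := by
        have := abs_im_le_norm (w - 1)
        simpa [hw] using this
      rw [div_le_one (by linarith)]
      linarith
    calc ‖deriv riemannZeta w / riemannZeta w‖
        = ‖(deriv riemannZeta w / riemannZeta w + 1 / (w - 1)) - 1 / (w - 1)‖ := by
          rw [add_sub_cancel_right]
      _ ≤ ‖deriv riemannZeta w / riemannZeta w + 1 / (w - 1)‖ + ‖1 / (w - 1)‖ :=
          norm_sub_le _ _
      _ ≤ C * ℓ + 1 := add_le_add h4 hinv
  -- mean value inequality on `[σ, σ₁]`
  have hMV : ‖g σ₁ - g σ‖ ≤ (C * ℓ + 1) * (σ₁ - σ) := by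
    have h := norm_image_sub_le_of_norm_deriv_le_segment' (f := g)
      (f' := fun u ↦ deriv riemannZeta ((u : ℂ) + t * I) / riemannZeta ((u : ℂ) + t * I))
      (a := σ) (b := σ₁) (C := C * ℓ + 1)
      (fun u hu ↦ (hderiv u hu.1).hasDerivWithinAt) (fun u hu ↦ hbound u hu.1)
    exact h σ₁ ⟨hcase.le, le_rfl⟩
  -- the value at `σ₁`
  have hgσ₁ : ‖g σ₁‖ ≤ Real.log ℓ + Real.log 2 := by
    have h := norm_logZeta_sub_log_le_of_le_re (s := (σ₁ : ℂ) + t * I) (by simp [hσ₁def, hℓ])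
    simpa [hgdef] using h
  -- the value at `σ` is the quantity to bound
  have hgσ : g σ = logZeta₁ s - Complex.log (s - 1) := by
    have : (σ : ℂ) + t * I = s := by
      apply Complex.ext <;> simp [hσdef, htdef]
    simp only [hgdef, this]
  -- width of the segment
  have hwidth : σ₁ - σ ≤ (1 + 4 * zfrConst) / ℓ := by
    have : zfrWidth t = 4 * zfrConst / ℓ := rfl
    rw [add_div, hσ₁def]
    linarith
  have hprod : (C * ℓ + 1) * (σ₁ - σ) ≤ (C + 1) * (1 + 4 * zfrConst) := by
    calc (C * ℓ + 1) * (σ₁ - σ) ≤ (C * ℓ + 1) * ((1 + 4 * zfrConst) / ℓ) :=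
          mul_le_mul_of_nonneg_left hwidth (by positivity)
      _ = (C + 1 / ℓ) * (1 + 4 * zfrConst) := by field_simp
      _ ≤ (C + 1) * (1 + 4 * zfrConst) := by
          gcongr
          rw [div_le_one hℓ0]; exact hℓ1.le
  rw [← hgσ]
  calc ‖g σ‖ = ‖g σ₁ - (g σ₁ - g σ)‖ := by rw [sub_sub_cancel]
    _ ≤ ‖g σ₁‖ + ‖g σ₁ - g σ‖ := norm_sub_le _ _
    _ ≤ (Real.log ℓ + Real.log 2) + (C + 1) * (1 + 4 * zfrConst) :=
        add_le_add hgσ₁ (hMV.trans hprod)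
    _ = Real.log ℓ + (Real.log 2 + (C + 1) * (1 + 4 * zfrConst)) := by ring

/-! ### Boundedness of `logZeta₁` near `s = 1` -/

/-- The closed box `[1 − w₁/2, 2] × [−1, 1]` (`w₁ = zfrWidth 1`) lies in the region. [folklore] -/
theorem box_subset_zfrRegion :
    (Icc (1 - zfrWidth 1 / 2) 2 ×ℂ Icc (-1) 1) ⊆ zfrRegion := by
  intro s hs
  obtain ⟨⟨hre, -⟩, him1, him2⟩ := hs
  have habs : |s.im| ≤ |(1 : ℝ)| := by rw [abs_one]; exact abs_le.2 ⟨him1, him2⟩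
  have hw : zfrWidth 1 ≤ zfrWidth s.im := zfrWidth_anti habs
  have hw0 : 0 < zfrWidth 1 := zfrWidth_pos 1
  show 1 - zfrWidth s.im < s.re
  linarith

/-- **`logZeta₁` is bounded near `s = 1`**: there is `M` with `‖logZeta₁ s‖ ≤ M` on the box
`1 − zfrWidth 1 / 2 ≤ σ ≤ 2`, `|t| ≤ 1` (continuity on a compact subset of the region). [folklore] -/
theorem exists_norm_logZeta₁_le_near_one :
    ∃ M : ℝ, 0 ≤ M ∧ ∀ s : ℂ, |s.im| ≤ 1 → 1 - zfrWidth 1 / 2 ≤ s.re → s.re ≤ 2 →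
      ‖logZeta₁ s‖ ≤ M := by
  have hK : IsCompact (Icc (1 - zfrWidth 1 / 2) 2 ×ℂ Icc (-1 : ℝ) 1) :=
    isCompact_Icc.reProdIm isCompact_Icc
  obtain ⟨M, hM⟩ := hK.exists_bound_of_continuousOn
    (continuousOn_logZeta₁.mono box_subset_zfrRegion)
  refine ⟨max M 0, le_max_right _ _, fun s ht hre1 hre2 ↦ ?_⟩
  have hs : s ∈ Icc (1 - zfrWidth 1 / 2) 2 ×ℂ Icc (-1 : ℝ) 1 :=
    ⟨⟨hre1, hre2⟩, abs_le.1 ht⟩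
  exact (hM s hs).trans (le_max_left _ _)

end SatheSelberg

end Literature.NumberTheory.LFunctions
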